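import Summits.Ventures.HSemireg.UntwistFullSigma
import Mathlib.Algebra.Homology.DerivedCategory.Basic
import Mathlib.CategoryTheory.Shift.CommShift
import HarnessLib

/-!
# Venture HSemireg — route R1.0, kernel clause on COMPLEX carriers: the comparison `θ` on
# `Hom_{D(X₀)}(E₀, E₀⟦2⟧)` made real from a fully faithful shift-commuting functor

HONEST FRAMING. Category theory (a full, faithful functor commuting with the shifts induces a bijection
`Hom(E, E⟦n⟧) → Hom(ΨE, (ΨE)⟦n⟧)`) composed with the triangular transport of `UntwistFullSigma.lean`. No derived
pull-back, no twist functor, no gerbe and no variety is constructed; nothing here says HC, HC_CM or HC_AV is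
proved.

## Why this file (referee ref-2 (S1)/(P2), red-4 R4-11(b), on the four sheaf-typed th-4 files)

The route's object `E₀ = Φ(I_p ⊠ I_q)` on the abelian fourfold `X₀ = X × X̂` is a TWO-TERM PERFECT COMPLEX
(amplitude `[-1, 0]`, rank `-2`), not a sheaf: its `Ext²_{X₀}(E₀, E₀)` (dimension `18` in the STEP-0 (C) data) is
`Hom_{D(Mod 𝒪_{X₀})}(E₀, E₀⟦2⟧)`, NOT Mathlib's `Ext` of two objects of an abelian category. (DICTIONARY, ref-2
(D2): the cell computes this `Ext²` in `D^b(Coh X₀)` / `D(QCoh X₀)`; the carrier below is `Hom` in Mathlib's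
`D(Mod 𝒪_{X₀})` of ALL `𝒪`-modules; for the bounded coherent `E₀` on the noetherian separated `X₀` the two agree —
`D^b(Coh X) ⥲ D^b_coh(X)` [GortzWedhorn2023, Thm. 22.42; HuybrechtsFM2006, Prop. 3.5] — a standard comparison NOT in
this file; cf. `DerivedEquivalenceTransport.lean`, «WHICH CATEGORY».) Hence none of the
REAL-`θ` statements of `UntwistExtEquivalence.lean` / `UntwistGerbePullback.lean` / `UntwistGerbeWeights.lean`
(all sheaf-typed) reaches `E₀`; for it only the abstract-`θ` lemma
`UntwistFullSigma.jointlyInjective_iff_of_triangular` applied so far, with the bijectivity of `θ` a hypothesis.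
This file supplies the complex-carrier form: the carrier is `Hom(E, E⟦2⟧)` in ANY category with a shift
(intended: `D(Mod 𝒪_{X₀})`, Mathlib's `DerivedCategory`), and `θ` is the REAL map
`x ↦ Ψ x ≫ (Ψ.commShiftIso 2)_E : Hom(E, E⟦2⟧) → Hom(ΨE, (ΨE)⟦2⟧)` of a functor `Ψ` that is full, faithful and
commutes with the shifts (intended: `Ψ = D(- ⊗ L^{∓1}) ∘ D(π^*) : D(Mod 𝒪_{X₀}) → D(Mod 𝒪_{𝔊₀})`,
`E₀ ↦ E₀′ = π^*E₀ ⊗ L^{∓1}`). What makes `θ` bijective is now the single named input «`Ψ` is full and faithful»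
(ref-2 (D1): of the four binders on `Ψ`, `CommShift ℤ` and `Additive` are Mathlib-DISCHARGEABLE for the intended
`Ψ` — `Functor.mapDerivedCategory` of an exact functor carries both instances — so the genuine input is full
faithfulness; and what the kernel clause CONSUMES is only the object-wise bijectivity of `θ` at `E₀`, `n = 2`:
`jointlyInjective_iff_of_bijective_commShift`, red-4 R4-20(vi)). For the `μ₂`-gerbe this is the derived
comparison `Hom_{D(𝔊₀)}(π^*A, π^*B⟦n⟧) = Hom_{D(X₀)}(A, Rπ_*π^*B⟦n⟧) = Hom_{D(X₀)}(A, B⟦n⟧)` (`Rπ_*π^* = id`: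
`R^{>0}π_* = 0` for the tame gerbe and the projection formula [Alper2013, Prop. 4.5, published numbering],
PRINTED for quasi-coherent sheaves; reading it on `D(Mod 𝒪)` of ALL `𝒪`-modules, as the carrier below does, is a
SEAT DERIVATION — étale-locally `[U/μ₂]`, `2 ∈ 𝒪^×` — exactly as in `UntwistGerbePullback.lean` (ref-2 (D3));
cell: lit-1 GERBE-SCOPE-LOCATORS (P3)) composed with the autoequivalence `- ⊗ L^{∓1}` — the way seat p6's
`DerivedEquivalenceTransport.lean` treats Orlov's equivalence ([Orlov2002DerivedAbelian] p. 3: «a functor is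
fully faithful if `Hom(A, B) → Hom(FA, FB)` is a bijection»). It is NOT proved in this file; the sequel
`UntwistDerivedAdjunction.lean` DERIVES it from sheaf-level data (an exact adjoint pair `π^* ⊣ π_*` with `π^*`
fully faithful ⟹ `D(π^*)` fully faithful; an additive autoequivalence ⟹ its derived functor fully faithful).

## What is PROVED here (0 sorry, 0 named facts, no definitions)

* `map_comp_commShiftIso_bijective` — `Ψ : C ⥤ D` full, faithful, commuting with `ℤ`-shifts:
  `x ↦ Ψ x ≫ (Ψ.commShiftIso n)_B : Hom(A, B⟦n⟧) → Hom(ΨA, (ΨB)⟦n⟧)` is bijective, all `A B n`.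
* `jointlyInjective_iff_of_bijective_commShift` — the same clause with the MINIMAL input: object-wise bijectivity of
  `θ = (x ↦ Ψ x ≫ (Ψ.commShiftIso 2)_E)` on `Hom(E, E⟦2⟧)` only (no global fullness / faithfulness of `Ψ`).
* `jointlyInjective_iff_of_fullyFaithful_commShift` (+ the one-sided `jointlyInjective_of_fullyFaithful_commShift`,
  the direction R1.0 CONSUMES — scheme ⟹ gerbe — which uses the SURJECTIVITY of `θ`) — preadditive `C`, `D`,
  `Ψ` additive: component families `σ_q : Hom(E, E⟦2⟧) → W_q`, `σ′_q : Hom(ΨE, (ΨE)⟦2⟧) → W′_q` with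
  `σ′_q(θ x) = d_q(σ_q x) + Σ_{j<q} u_{q,j}(σ_j x)` on a LOWER set `I` (the Leibniz rule, a hypothesis), `d_q`
  injective on `I` (intended `π^*` on `H^{q+2}(Ω^q)`), `u` arbitrary ⟹ `(σ_q)_{q ∈ I}` jointly injective iff
  `(σ′_q)_{q ∈ I}` is.
* `jointlyInjective_iff_complex_of_fullyFaithful_commShift`, `jointlyInjective_univ_complex_of_fullyFaithful_commShift`
  — THE SCHEME CASE: `C = DerivedCategory (Mod 𝒪_{X₀})` for `X₀` over `Spec S`, `E = Q(E₀)` for an honest cochain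
  complex `E₀` of `𝒪_{X₀}`-modules (intended: the two-term complex), `D` any preadditive category with shift
  (intended `D(Mod 𝒪_{𝔊₀})`), `Ψ` as above: the kernel clause on `Hom_{D(X₀)}(E₀, E₀⟦2⟧)`, every lower `I`, and the
  FULL-map consumed direction «all `σ_q^{E₀}` jointly injective ⟹ all `σ′_q` jointly injective on
  `Hom(ΨE₀, (ΨE₀)⟦2⟧)`».

## What is NOT proved here (declared inputs, with their printed sources)

* «`Ψ` full and faithful» for `Ψ = D(- ⊗ L^{∓1}) ∘ D(π^*)`: the derived comparison above (tame `μ₂`-gerbe;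
  weight decomposition [Lieblich2007, arXiv Lemma 2.1.1.12, Prop. 2.2.1.6]; [Alper2013, Prop. 4.5]) and
  «`- ⊗ L` is an autoequivalence»; no functor is constructed.
* The components `σ_q` for a perfect complex (no trace / `σ` for complexes in the tree: `ComplexAtiyahClass.lean`,
  `ComplexAtiyahPower.lean` have `At`, `At^q` for complexes, not `σ_q`) — they enter as abstract additive maps.
* The Leibniz rule `At(𝓕 ⊗ M) = At(𝓕) ⊗ 1 + 1 ⊗ c₁(M)` for complexes [HuybrechtsLehn1997, §10.1.5 (held: CUP 2nd ed. 2010, same numbering);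
  Atiyah1957, Prop. 10–12 for bundles] — the hypothesis `hσ`.

## References

* D. Orlov, *Derived categories of coherent sheaves on abelian varieties and equivalences between them*,
  Izv. Math. 66 (2002), p. 3. [Orlov2002DerivedAbelian]
* J. Alper, *Good moduli spaces for Artin stacks*, Ann. Inst. Fourier 63 (2013), Prop. 4.5. [Alper2013]
* M. Lieblich, *Moduli of twisted sheaves*, Duke Math. J. 138 (2007); arXiv:math/0411337 Lemma 2.1.1.12,
  Prop. 2.2.1.6. [Lieblich2007]
* R.-O. Buchweitz, H. Flenner, Compositio Math. 137 (2003), Def. 4.1, §5. [BuchweitzFlenner2003]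
* U. Görtz, T. Wedhorn, *Algebraic Geometry II* (2023), Thm. 22.42. [GortzWedhorn2023]
* D. Huybrechts, *Fourier–Mukai transforms in algebraic geometry* (2006), Prop. 3.5. [HuybrechtsFM2006]
-/

open CategoryTheory CategoryTheory.Limits AlgebraicGeometry

namespace Summit.Ventures.HSemireg

/-! ### The comparison map of a fully faithful shift-commuting functor -/

section Theta

universe v v' u u'

variable {C : Type u} [Category.{v} C] {D : Type u'} [Category.{v'} D] [HasShift C ℤ] [HasShift D ℤ]
  (Ψ : C ⥤ D) [Ψ.CommShift ℤ] [Ψ.Full] [Ψ.Faithful]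

/-- **`θ` is bijective.** For `Ψ : C ⥤ D` full, faithful and commuting with the `ℤ`-shifts, the map
`Hom(A, B⟦n⟧) → Hom(ΨA, (ΨB)⟦n⟧)`, `x ↦ Ψ x ≫ (Ψ.commShiftIso n)_B`, is a bijection (injective: `Ψ` faithful and
`(Ψ.commShiftIso n)_B` an isomorphism; surjective: `Ψ` full). Intended: `Ψ = D(- ⊗ L^{∓1}) ∘ D(π^*)`, `n = 2`,
`A = B = E₀`, giving the R1.0 map `θ : Hom_{D(X₀)}(E₀, E₀⟦2⟧) → Hom_{D(𝔊₀)}(E₀′, E₀′⟦2⟧)`.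
[cite: Orlov2002DerivedAbelian, p. 3 L33–40 (fully faithful = bijection on Hom)] -/
theorem map_comp_commShiftIso_bijective (A B : C) (n : ℤ) :
    Function.Bijective (fun x : A ⟶ B⟦n⟧ => Ψ.map x ≫ ((Ψ.commShiftIso n).app B).hom) := by
  refine ⟨fun x x' h => Ψ.map_injective ((Iso.cancel_iso_hom_right _ _ _).1 h), fun y => ?_⟩
  obtain ⟨x, hx⟩ := Ψ.map_surjective (y ≫ ((Ψ.commShiftIso n).app B).inv)
  exact ⟨x, by simp only [hx, Category.assoc, Iso.inv_hom_id, Category.comp_id]⟩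

end Theta

/-! ### Kernel clause on `Hom(E, E⟦2⟧)` carriers -/

section KernelClause

universe v v' u u'

variable {C : Type u} [Category.{v} C] [Preadditive C] {D : Type u'} [Category.{v'} D] [Preadditive D]
  [HasShift C ℤ] [HasShift D ℤ] (Ψ : C ⥤ D) [Ψ.Additive] [Ψ.CommShift ℤ] [Ψ.Full] [Ψ.Faithful]
  {W W' : ℕ → Type*} [∀ q, AddCommGroup (W q)] [∀ q, AddCommGroup (W' q)]
  {E : C} {σ : ∀ q, (E ⟶ E⟦(2 : ℤ)⟧) →+ W q}
  {σ' : ∀ q, (Ψ.obj E ⟶ (Ψ.obj E)⟦(2 : ℤ)⟧) →+ W' q}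

omit [Ψ.Full] [Ψ.Faithful] in
/-- **Kernel clause of R1.0 on complex carriers — MINIMAL input: object-wise bijectivity of `θ`.** `C`, `D`
preadditive with `ℤ`-shifts, `Ψ : C ⥤ D` additive commuting with the shifts (NO global fullness / faithfulness),
`E : C` (intended the two-term complex `E₀`, `n = 2`), and suppose only that
`θ = (x ↦ Ψ x ≫ (Ψ.commShiftIso 2)_E) : Hom(E, E⟦2⟧) → Hom(ΨE, (ΨE)⟦2⟧)` is bijective (the object-wise derived
comparison at `E₀` — exactly what the route consumes, red-4 R4-20(vi)). Components related through `θ`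
triangularly on a LOWER set `I` with injective diagonal ⟹ `(σ_q)_{q ∈ I}` jointly injective iff `(σ′_q)_{q ∈ I}`
is. [cite: BuchweitzFlenner2003, §5 (I-semiregular)] -/
theorem jointlyInjective_iff_of_bijective_commShift
    (hθ : Function.Bijective (fun x : E ⟶ E⟦(2 : ℤ)⟧ => Ψ.map x ≫ ((Ψ.commShiftIso (2 : ℤ)).app E).hom))
    (d : ∀ q, W q →+ W' q) (u : ∀ q j, W j →+ W' q) {I : Set ℕ} (hI : IsLowerSet I)
    (hd : ∀ q ∈ I, Function.Injective (d q))
    (hσ : ∀ q ∈ I, ∀ x : E ⟶ E⟦(2 : ℤ)⟧,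
      σ' q (Ψ.map x ≫ ((Ψ.commShiftIso (2 : ℤ)).app E).hom) =
        d q (σ q x) + ∑ j ∈ Finset.range q, u q j (σ j x)) :
    (∀ x : E ⟶ E⟦(2 : ℤ)⟧, (∀ q ∈ I, σ q x = 0) → x = 0) ↔
      ∀ x' : Ψ.obj E ⟶ (Ψ.obj E)⟦(2 : ℤ)⟧, (∀ q ∈ I, σ' q x' = 0) → x' = 0 := by
  let θ : (E ⟶ E⟦(2 : ℤ)⟧) ≃+ (Ψ.obj E ⟶ (Ψ.obj E)⟦(2 : ℤ)⟧) :=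
    AddEquiv.mk' (Equiv.ofBijective _ hθ) fun x y => by
      change Ψ.map (x + y) ≫ _ = Ψ.map x ≫ _ + Ψ.map y ≫ _
      rw [Ψ.map_add]
      exact Preadditive.add_comp _ _ _ _ _ _
  exact jointlyInjective_iff_of_triangular (σ := σ) (σ' := σ') θ d u hI hd fun q hq x => hσ q hq x

/-- **Kernel clause of R1.0 on complex carriers, real `θ`.** `C`, `D` preadditive with `ℤ`-shifts (intended
`D(Mod 𝒪_{X₀})`, `D(Mod 𝒪_{𝔊₀})`), `Ψ : C ⥤ D` additive, full, faithful, commuting with the shifts (intended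
`D(- ⊗ L^{∓1}) ∘ D(π^*)`; its full faithfulness is the derived comparison — printed for `QCoh`, a seat derivation
on `D(Mod 𝒪)` — an INPUT here, derived from sheaf-level data in `UntwistDerivedAdjunction.lean`), `E : C` (intended
the two-term complex `E₀`), components `σ_q` on `Hom(E, E⟦2⟧)` and `σ′_q` on `Hom(ΨE, (ΨE)⟦2⟧)` related through
`θ x = Ψ x ≫ (Ψ.commShiftIso 2)_E` by `σ′_q(θ x) = d_q(σ_q x) + Σ_{j<q} u_{q,j}(σ_j x)` for `q` in a LOWER set
`I`, `d_q` injective on `I`, `u` arbitrary. Then `(σ_q)_{q ∈ I}` is jointly injective iff `(σ′_q)_{q ∈ I}` is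
(`UntwistFullSigma.jointlyInjective_iff_of_triangular` with the real additive bijection `θ`).
[cite: BuchweitzFlenner2003, §5 (I-semiregular); Orlov2002DerivedAbelian, p. 3 L33–40] -/
theorem jointlyInjective_iff_of_fullyFaithful_commShift (d : ∀ q, W q →+ W' q)
    (u : ∀ q j, W j →+ W' q) {I : Set ℕ} (hI : IsLowerSet I)
    (hd : ∀ q ∈ I, Function.Injective (d q))
    (hσ : ∀ q ∈ I, ∀ x : E ⟶ E⟦(2 : ℤ)⟧,
      σ' q (Ψ.map x ≫ ((Ψ.commShiftIso (2 : ℤ)).app E).hom) =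
        d q (σ q x) + ∑ j ∈ Finset.range q, u q j (σ j x)) :
    (∀ x : E ⟶ E⟦(2 : ℤ)⟧, (∀ q ∈ I, σ q x = 0) → x = 0) ↔
      ∀ x' : Ψ.obj E ⟶ (Ψ.obj E)⟦(2 : ℤ)⟧, (∀ q ∈ I, σ' q x' = 0) → x' = 0 := by
  let θ : (E ⟶ E⟦(2 : ℤ)⟧) ≃+ (Ψ.obj E ⟶ (Ψ.obj E)⟦(2 : ℤ)⟧) :=
    AddEquiv.mk' (Equiv.ofBijective _ (map_comp_commShiftIso_bijective Ψ E E 2)) fun x y => by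
      change Ψ.map (x + y) ≫ _ = Ψ.map x ≫ _ + Ψ.map y ≫ _
      rw [Ψ.map_add]
      exact Preadditive.add_comp _ _ _ _ _ _
  exact jointlyInjective_iff_of_triangular (σ := σ) (σ' := σ') θ d u hI hd fun q hq x => hσ q hq x

/-- **The direction route R1.0 consumes, complex carriers**: if `(σ_q)_{q ∈ I}` is jointly injective on
`Hom(E, E⟦2⟧)` (intended: `E₀` is `I`-semiregular on `X₀`), then `(σ′_q)_{q ∈ I}` is jointly injective on
`Hom(ΨE, (ΨE)⟦2⟧)` (intended: `E₀′ = π^*E₀ ⊗ L^{∓1}` on `𝔊₀`, where Pridham's obstruction theory runs). Uses only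
the SURJECTIVITY of `θ` (fullness of `Ψ`) and injectivity of the diagonal.
[cite: BuchweitzFlenner2003, §5 (I-semiregular); Orlov2002DerivedAbelian, p. 3 L33–40] -/
theorem jointlyInjective_of_fullyFaithful_commShift (d : ∀ q, W q →+ W' q)
    (u : ∀ q j, W j →+ W' q) {I : Set ℕ} (hI : IsLowerSet I)
    (hd : ∀ q ∈ I, Function.Injective (d q))
    (hσ : ∀ q ∈ I, ∀ x : E ⟶ E⟦(2 : ℤ)⟧,
      σ' q (Ψ.map x ≫ ((Ψ.commShiftIso (2 : ℤ)).app E).hom) =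
        d q (σ q x) + ∑ j ∈ Finset.range q, u q j (σ j x))
    (h : ∀ x : E ⟶ E⟦(2 : ℤ)⟧, (∀ q ∈ I, σ q x = 0) → x = 0)
    (x' : Ψ.obj E ⟶ (Ψ.obj E)⟦(2 : ℤ)⟧) (hx' : ∀ q ∈ I, σ' q x' = 0) : x' = 0 :=
  (jointlyInjective_iff_of_fullyFaithful_commShift Ψ d u hI hd hσ).1 h x' hx'

end KernelClause

/-! ### The scheme case: `Hom_{D(Mod 𝒪_{X₀})}(E₀, E₀⟦2⟧)` for an honest cochain complex `E₀` -/

section Schemes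

universe w v' u u'

variable {S : Type u} [CommRing S] {X₀ : Over (Spec (CommRingCat.of S))}
  [HasDerivedCategory.{w} X₀.left.Modules]
  {D : Type u'} [Category.{v'} D] [Preadditive D] [HasShift D ℤ]
  (Ψ : DerivedCategory X₀.left.Modules ⥤ D) [Ψ.Additive] [Ψ.CommShift ℤ] [Ψ.Full] [Ψ.Faithful]
  (E₀ : CochainComplex X₀.left.Modules ℤ)
  {W W' : ℕ → Type*} [∀ q, AddCommGroup (W q)] [∀ q, AddCommGroup (W' q)]
  {σ : ∀ q, (DerivedCategory.Q.obj E₀ ⟶ (DerivedCategory.Q.obj E₀)⟦(2 : ℤ)⟧) →+ W q}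
  {σ' : ∀ q, (Ψ.obj (DerivedCategory.Q.obj E₀) ⟶ (Ψ.obj (DerivedCategory.Q.obj E₀))⟦(2 : ℤ)⟧) →+ W' q}

/-- **Kernel clause for a COMPLEX `E₀` on `X₀/S`.** `E₀` any cochain complex of `𝒪_{X₀}`-modules (intended:
the two-term perfect complex `Φ(I_p ⊠ I_q)`, `Hom_{D(X₀)}(E₀, E₀⟦2⟧)` of dimension `18`), viewed in Mathlib's
derived category `D(Mod 𝒪_{X₀})`; `Ψ : D(Mod 𝒪_{X₀}) ⥤ D` additive, full, faithful, commuting with the shifts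
(intended `D(- ⊗ L^{∓1}) ∘ D(π^*)` into `D(Mod 𝒪_{𝔊₀})`; WHICH `Ψ` exist is not asserted); `σ_q`, `σ′_q`
abstract components (no `σ` for complexes in the tree) related through the real `θ` triangularly on a lower set
`I` with injective diagonal. Then joint injectivity of `(σ_q)_{q ∈ I}` on `Hom(E₀, E₀⟦2⟧)` is equivalent to that
of `(σ′_q)_{q ∈ I}` on `Hom(ΨE₀, (ΨE₀)⟦2⟧)`. [cite: BuchweitzFlenner2003, §5 (I-semiregular);
Orlov2002DerivedAbelian, p. 3 L33–40; Alper2013, Prop. 4.5 (the input «D(π^*) fully faithful»)] -/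
theorem jointlyInjective_iff_complex_of_fullyFaithful_commShift (d : ∀ q, W q →+ W' q)
    (u : ∀ q j, W j →+ W' q) {I : Set ℕ} (hI : IsLowerSet I)
    (hd : ∀ q ∈ I, Function.Injective (d q))
    (hσ : ∀ q ∈ I, ∀ x : DerivedCategory.Q.obj E₀ ⟶ (DerivedCategory.Q.obj E₀)⟦(2 : ℤ)⟧,
      σ' q (Ψ.map x ≫ ((Ψ.commShiftIso (2 : ℤ)).app _).hom) =
        d q (σ q x) + ∑ j ∈ Finset.range q, u q j (σ j x)) :
    (∀ x : DerivedCategory.Q.obj E₀ ⟶ (DerivedCategory.Q.obj E₀)⟦(2 : ℤ)⟧,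
        (∀ q ∈ I, σ q x = 0) → x = 0) ↔
      ∀ x' : Ψ.obj (DerivedCategory.Q.obj E₀) ⟶ (Ψ.obj (DerivedCategory.Q.obj E₀))⟦(2 : ℤ)⟧,
        (∀ q ∈ I, σ' q x' = 0) → x' = 0 :=
  jointlyInjective_iff_of_fullyFaithful_commShift Ψ d u hI hd hσ

/-- **FULL map, consumed direction, for a complex `E₀` on `X₀/S`**: all `σ_q^{E₀}` jointly injective on
`Hom_{D(X₀)}(E₀, E₀⟦2⟧)` (intended: FULL `σ_{E₀}` injective — the engines' certificate for the STEP-0 object)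
⟹ all `σ′_q` jointly injective on `Hom(ΨE₀, (ΨE₀)⟦2⟧)` (intended: `E₀′ = π^*E₀ ⊗ L^{∓1}` fully semiregular on the
gerbe), given `Ψ` full faithful shift-commuting (the derived comparison, an input), injective diagonals `d_q`
(intended `π^*` on Hodge cohomology) and the Leibniz-rule re-expansion (a hypothesis).
[cite: BuchweitzFlenner2003, Def. 4.1 and §5; Orlov2002DerivedAbelian, p. 3 L33–40] -/
theorem jointlyInjective_univ_complex_of_fullyFaithful_commShift (d : ∀ q, W q →+ W' q)
    (u : ∀ q j, W j →+ W' q) (hd : ∀ q, Function.Injective (d q))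
    (hσ : ∀ (q : ℕ) (x : DerivedCategory.Q.obj E₀ ⟶ (DerivedCategory.Q.obj E₀)⟦(2 : ℤ)⟧),
      σ' q (Ψ.map x ≫ ((Ψ.commShiftIso (2 : ℤ)).app _).hom) =
        d q (σ q x) + ∑ j ∈ Finset.range q, u q j (σ j x))
    (h : ∀ x : DerivedCategory.Q.obj E₀ ⟶ (DerivedCategory.Q.obj E₀)⟦(2 : ℤ)⟧, (∀ q, σ q x = 0) → x = 0)
    (x' : Ψ.obj (DerivedCategory.Q.obj E₀) ⟶ (Ψ.obj (DerivedCategory.Q.obj E₀))⟦(2 : ℤ)⟧)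
    (hx' : ∀ q, σ' q x' = 0) : x' = 0 :=
  jointlyInjective_of_fullyFaithful_commShift Ψ d u isLowerSet_univ (fun q _ => hd q) (fun q _ => hσ q)
    (fun x hx => h x fun q => hx q (Set.mem_univ q)) x' fun q _ => hx' q

end Schemes

end Summit.Ventures.HSemireg
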